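import Summits.SmoothPoincare4.SmoothPoincare4.Theses.WeakReductionDescent
import Summits.SmoothPoincare4.SmoothPoincare4.Theorems.WeakReductionDescentWeakReductionReducesStubLoopDichotomyAux2
import Summits.SmoothPoincare4.SmoothPoincare4.Theorems.WeakReductionDescentWeakReductionReducesStubLoopDichotomyFourAux1
import Summits.SmoothPoincare4.SmoothPoincare4.Theorems.WeakReductionDescentWeakReductionReducesStubLoopDichotomyFourCoreAux1
import Summits.SmoothPoincare4.SmoothPoincare4.Theorems.WeakReductionDescentWeakReductionReducesStubLoopFromGenusThreeAux5
import Literature.Topology.FourManifolds.SmallTrisectionsChiZeroProofs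
import HarnessLib

/-!
# Crux `WeakReductionReduces` (stmt-SmoothPoincare4-17908), line `loop_dichotomy` — skeleton v6 glue
# (genuine cores) and the RUNG-4 MILESTONE: `K2 at genus 4 ⇐ CORE₄ᵍ ∧ MSZ16 Thm 1.2`

Lead seat c2 (2026-08-17).  **Everything here is proved; no definition and no named fact is
introduced** (the Meier–Schirmer–Zupan classification enters as an explicit hypothesis, the tree's
consolidated named fact `msz_trisection_classification_gk`).  Registered helpers (stub-add on the
crux; `--supports stmt-SmoothPoincare4-17908`):

* `helper_loopDichotomyFourCoreNorm_of_genuine : CORE₄ᵍ → CORE₄ⁿ` and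
  `helper_loopDichotomyFromFiveCoreNorm_of_genuine : CORE₅ᵍ → CORE₅ⁿ` — the v6 glue: for a homotopy
  sphere (`π₁(M) = 1`, `simplyConnectedSpace_sphere_four_holds`) neither curve of a fixed-label weak
  reduction `(c; c′)` is a reducing curve (`c′` does not compress in `H₀`, `c` not in both `H₁` and
  `H₂`), by the PROVED tree theorem `Trisection.not_simplyConnectedSpace_of_reducing_nonseparating`;
  so the normalised cores CORE₄ⁿ (`stub_loopDichotomyFourCoreNorm`, v5) / CORE₅ⁿ follow from the
  GENUINE cores CORE₄ᵍ (`stub_loopDichotomyFourCoreGenuine`, v6) / CORE₅ᵍ.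
* `helper_rungFour_of_coreFourGenuine_msz : CORE₄ᵍ → MSZ16 Thm 1.2 → K2 at genus 4` — the milestone
  the line card states in prose ("rung 4 of K2 = Aranda–Zupan at genus 4 for homotopy spheres,
  modulo MSZ16 + Pao"), kernel-checked: for a smooth homotopy 4-sphere `M` and a MINIMAL weakly
  reducible `(4; k)`-GK-trisection `T`, `T` is reducible — GIVEN CORE₄ᵍ and the classification.
  Proof: `χ = 2 ⇒ Σ kᵢ = 4` (`genus_eq_sum_of_isGKTrisection_of_homotopyEquiv`); a type in the MSZ
  range makes `M ≅ S⁴` (`msz_homotopySphere_gk_of_classification`), contradicting minimality through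
  the genus-`0` trisection of `S⁴`; otherwise `kᵢ ≤ 2` and D₄
  (`helper_loopDichotomyFour_of_irreducibleCore ∘ helper_loopDichotomyFourCore_of_normalised ∘` the
  genuine glue) gives: reducible (done) ∨ a smaller trisection (contradicts minimality) ∨ a loop
  surgery `M = X_ℓ` on a genus-`≤ 3`-trisected `X`, and then L₃ (`helper_loopFromGenusThree_of_msz`
  fed by `msz_chiZero_circleProdSphereThree_gk_of_classification`: `χ(X) = 0` ⇒ MSZ range ⇒
  `X ≅ S¹ × S³` ⇒ Pao) makes `M ≅ S⁴`, contradicting minimality again.  Rungs `≥ 5` are NOT touched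
  (they need CORE₅ᵍ and the residue H_res′).

## References

* R. Aranda, A. Zupan, *Manifolds with weakly reducible genus-three trisections are standard*,
  arXiv:2503.04607 (2025), Thm. 1.3 (p. 2), §2 (p. 6), §5, §6 (p. 20). [ArandaZupan2025]
* J. Meier, T. Schirmer, A. Zupan, *Classification of trisections and the Generalized Property R
  Conjecture*, Proc. AMS 144 (2016), arXiv:1507.06561, Thm. 1.2, Remark 3.12. [MeierSchirmerZupan2016]
* P. S. Pao, *The topological structure of 4-manifolds with effective torus actions. I*, Trans. AMS
  227 (1977), Thm. [Pao1977]
* A. Hatcher, *Algebraic Topology*, CUP (2002), Prop. 1.26. [HatcherAT2002]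
-/

-- the registered namespace `Summit.SmoothPoincare4.SmoothPoincare4.Theorems…` repeats a component
set_option linter.dupNamespace false

noncomputable section

open scoped Manifold ContDiff Topology ContinuousMap
open Set
open Literature.Topology.FourManifolds Literature.Topology.FourManifolds.Trisection

namespace Summit.SmoothPoincare4.SmoothPoincare4.Theorems.WeakReductionReduces.LoopDichotomy

/-- **The weak reduction of a homotopy sphere is genuine**: neither curve is a reducing curve —
`c′` does not compress in `H₀` and `c` does not compress in both `H₁` and `H₂` — because a
non-separating curve compressing in all three handlebodies forces `π₁(M) ≠ 1`
(`Trisection.not_simplyConnectedSpace_of_reducing_nonseparating`) while `M ≃ₕ S⁴` is simply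
connected. [cite: ArandaZupan2025, §2 (p. 6)] [cite: HatcherAT2002, Prop. 1.26] -/
theorem genuine_of_weakReduction_of_homotopyEquiv {M : Type} [TopologicalSpace M] [T2Space M]
    [SecondCountableTopology M] [ChartedSpace (EuclideanSpace ℝ (Fin 4)) M] [IsManifold (𝓡 4) ∞ M]
    (e : M ≃ₕ (Metric.sphere (0 : EuclideanSpace ℝ (Fin 5)) 1)) {g : ℕ} {k : Fin 3 → ℕ} {T : Fin 3 → Set M} (hT : IsGKTrisection M g k T)
    {c c' : Set M} (hc : IsCurve T c) (hc' : IsCurve T c')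
    (hn : IsNonSeparating T c) (hn' : IsNonSeparating T c')
    (hb0 : BoundsDisc T (spineHandlebody T 0) c) (hb1 : BoundsDisc T (spineHandlebody T 1) c')
    (hb2 : BoundsDisc T (spineHandlebody T 2) c') :
    ¬ BoundsDisc T (spineHandlebody T 0) c' ∧
      ¬ (BoundsDisc T (spineHandlebody T 1) c ∧ BoundsDisc T (spineHandlebody T 2) c) := by
  haveI : SimplyConnectedSpace (Metric.sphere (0 : EuclideanSpace ℝ (Fin 5)) 1) := simplyConnectedSpace_sphere_four_holds
  haveI : SimplyConnectedSpace M := e.simplyConnectedSpace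
  refine ⟨fun h0 => ?_, fun h12 => ?_⟩
  · refine not_simplyConnectedSpace_of_reducing_nonseparating hT hc' (fun q => ?_) hn' ‹_›
    fin_cases q
    · exact h0
    · exact hb1
    · exact hb2
  · refine not_simplyConnectedSpace_of_reducing_nonseparating hT hc (fun q => ?_) hn ‹_›
    fin_cases q
    · exact hb0
    · exact h12.1
    · exact h12.2

/-- **`helper_loopDichotomyFourCoreNorm_of_genuine` : CORE₄ᵍ → CORE₄ⁿ** (registered helper; v6 glue
at genus 4): feed the genuine core with the two free facts of
`genuine_of_weakReduction_of_homotopyEquiv`. [cite: ArandaZupan2025, §2 (p. 6), §6 (p. 20)] -/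
theorem helper_loopDichotomyFourCoreNorm_of_genuine :
    (∀ (M : Type) [TopologicalSpace M] [T2Space M] [SecondCountableTopology M] [ChartedSpace (EuclideanSpace ℝ (Fin 4)) M] [IsManifold (𝓡 4) ((⊤ : ℕ∞) : WithTop ℕ∞) M], (M ≃ₕ (Metric.sphere (0 : EuclideanSpace ℝ (Fin 5)) 1)) → ∀ (k : Fin 3 → ℕ) (T : Fin 3 → Set M), Literature.Topology.FourManifolds.IsGKTrisection M 4 k T → k 0 + k 1 + k 2 = 4 → (∀ i, k i ≤ 2) → 1 ≤ k 0 → k 2 ≤ k 1 → (∃ c c' : Set M, Literature.Topology.FourManifolds.Trisection.IsCurve T c ∧ Literature.Topology.FourManifolds.Trisection.IsCurve T c' ∧ Disjoint c c' ∧ Literature.Topology.FourManifolds.Trisection.IsNonSeparating T c ∧ Literature.Topology.FourManifolds.Trisection.IsNonSeparating T c' ∧ Literature.Topology.FourManifolds.Trisection.BoundsDisc T (Literature.Topology.FourManifolds.Trisection.spineHandlebody T 0) c ∧ Literature.Topology.FourManifolds.Trisection.BoundsDisc T (Literature.Topology.FourManifolds.Trisection.spineHandlebody T 1) c' ∧ Literature.Topology.FourManifolds.Trisection.BoundsDisc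 T (Literature.Topology.FourManifolds.Trisection.spineHandlebody T 2) c' ∧ ¬ Literature.Topology.FourManifolds.Trisection.BoundsDisc T (Literature.Topology.FourManifolds.Trisection.spineHandlebody T 0) c' ∧ ¬ (Literature.Topology.FourManifolds.Trisection.BoundsDisc T (Literature.Topology.FourManifolds.Trisection.spineHandlebody T 1) c ∧ Literature.Topology.FourManifolds.Trisection.BoundsDisc T (Literature.Topology.FourManifolds.Trisection.spineHandlebody T 2) c)) → ¬ Literature.Topology.FourManifolds.Trisection.IsReducible T → (∃ (g₁ : ℕ) (k₁ : Fin 3 → ℕ) (T₁ : Fin 3 → Set M), g₁ < 4 ∧ Literature.Topology.FourManifolds.IsGKTrisection M g₁ k₁ T₁) ∨ (∃ (X : Type) (_ : TopologicalSpace X) (_ : T2Space X) (_ : SecondCountableTopology X) (_ : ChartedSpace (EuclideanSpace ℝ (Fin 4)) X) (_ : IsManifold (𝓡 4) ((⊤ : ℕ∞) : WithTop ℕ∞) X) (g' : ℕ) (k' : Fin 3 → ℕ) (T' : Fin 3 → Set X) (ℓ : (Metric.sphere (0 : EuclideanSpace ℝ (Fin 2)) 1) → X), g' < 4 ∧ Literature.Topology.FourManifolds.IsGKTrisection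 X g' k' T' ∧ Manifold.IsSmoothEmbedding (𝓡 1) (𝓡 4) ((⊤ : ℕ∞) : WithTop ℕ∞) ℓ ∧ Literature.Topology.FourManifolds.IsCircleSurgery (𝓡 4) (𝓡 4) X M ℓ)) → ∀ (M : Type) [TopologicalSpace M] [T2Space M] [SecondCountableTopology M] [ChartedSpace (EuclideanSpace ℝ (Fin 4)) M] [IsManifold (𝓡 4) ((⊤ : ℕ∞) : WithTop ℕ∞) M], (M ≃ₕ (Metric.sphere (0 : EuclideanSpace ℝ (Fin 5)) 1)) → ∀ (k : Fin 3 → ℕ) (T : Fin 3 → Set M), Literature.Topology.FourManifolds.IsGKTrisection M 4 k T → k 0 + k 1 + k 2 = 4 → (∀ i, k i ≤ 2) → 1 ≤ k 0 → k 2 ≤ k 1 → (∃ c c' : Set M, Literature.Topology.FourManifolds.Trisection.IsCurve T c ∧ Literature.Topology.FourManifolds.Trisection.IsCurve T c' ∧ Disjoint c c' ∧ Literature.Topology.FourManifolds.Trisection.IsNonSeparating T c ∧ Literature.Topology.FourManifolds.Trisection.IsNonSeparating T c' ∧ Literature.Topology.FourManifolds.Trisection.BoundsDisc T (Literature.Topology.FourManifolds.Trisection.spineHandlebody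 T 0) c ∧ Literature.Topology.FourManifolds.Trisection.BoundsDisc T (Literature.Topology.FourManifolds.Trisection.spineHandlebody T 1) c' ∧ Literature.Topology.FourManifolds.Trisection.BoundsDisc T (Literature.Topology.FourManifolds.Trisection.spineHandlebody T 2) c') → ¬ Literature.Topology.FourManifolds.Trisection.IsReducible T → (∃ (g₁ : ℕ) (k₁ : Fin 3 → ℕ) (T₁ : Fin 3 → Set M), g₁ < 4 ∧ Literature.Topology.FourManifolds.IsGKTrisection M g₁ k₁ T₁) ∨ (∃ (X : Type) (_ : TopologicalSpace X) (_ : T2Space X) (_ : SecondCountableTopology X) (_ : ChartedSpace (EuclideanSpace ℝ (Fin 4)) X) (_ : IsManifold (𝓡 4) ((⊤ : ℕ∞) : WithTop ℕ∞) X) (g' : ℕ) (k' : Fin 3 → ℕ) (T' : Fin 3 → Set X) (ℓ : (Metric.sphere (0 : EuclideanSpace ℝ (Fin 2)) 1) → X), g' < 4 ∧ Literature.Topology.FourManifolds.IsGKTrisection X g' k' T' ∧ Manifold.IsSmoothEmbedding (𝓡 1) (𝓡 4) ((⊤ : ℕ∞) : WithTop ℕ∞) ℓ ∧ Literature.Topology.FourManifolds.IsCircleSurgery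 (𝓡 4) (𝓡 4) X M ℓ) := by
  intro hG M _ _ _ _ _ e k T hT hsum hk hk0 h21 hwr hirr
  obtain ⟨c, c', hc, hc', hd, hn, hn', hb0, hb1, hb2⟩ := hwr
  obtain ⟨hg0, hg12⟩ := genuine_of_weakReduction_of_homotopyEquiv e hT hc hc' hn hn' hb0 hb1 hb2
  exact hG M e k T hT hsum hk hk0 h21 ⟨c, c', hc, hc', hd, hn, hn', hb0, hb1, hb2, hg0, hg12⟩ hirr

/-- **`helper_loopDichotomyFromFiveCoreNorm_of_genuine` : CORE₅ᵍ → CORE₅ⁿ** (registered helper; v6 glue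
at rungs `≥ 5`; CORE₅ⁿ is the hypothesis of the landed
`helper_loopDichotomyFromFiveCorePos_of_normalised`). [cite: ArandaZupan2025, §2 (p. 6), §6 (p. 20)] -/
theorem helper_loopDichotomyFromFiveCoreNorm_of_genuine :
    (∀ (M : Type) [TopologicalSpace M] [T2Space M] [SecondCountableTopology M] [ChartedSpace (EuclideanSpace ℝ (Fin 4)) M] [IsManifold (𝓡 4) ((⊤ : ℕ∞) : WithTop ℕ∞) M], (M ≃ₕ (Metric.sphere (0 : EuclideanSpace ℝ (Fin 5)) 1)) → ∀ (g : ℕ) (k : Fin 3 → ℕ) (T : Fin 3 → Set M), Literature.Topology.FourManifolds.IsGKTrisection M g k T → 5 ≤ g → k 0 + k 1 + k 2 = g → (∀ i, k i + 2 ≤ g) → 1 ≤ k 0 → k 2 ≤ k 1 → (∃ c c' : Set M, Literature.Topology.FourManifolds.Trisection.IsCurve T c ∧ Literature.Topology.FourManifolds.Trisection.IsCurve T c' ∧ Disjoint c c' ∧ Literature.Topology.FourManifolds.Trisection.IsNonSeparating T c ∧ Literature.Topology.FourManifolds.Trisection.IsNonSeparating T c' ∧ Literature.Topology.FourManifolds.Trisection.BoundsDisc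 T (Literature.Topology.FourManifolds.Trisection.spineHandlebody T 0) c ∧ Literature.Topology.FourManifolds.Trisection.BoundsDisc T (Literature.Topology.FourManifolds.Trisection.spineHandlebody T 1) c' ∧ Literature.Topology.FourManifolds.Trisection.BoundsDisc T (Literature.Topology.FourManifolds.Trisection.spineHandlebody T 2) c' ∧ ¬ Literature.Topology.FourManifolds.Trisection.BoundsDisc T (Literature.Topology.FourManifolds.Trisection.spineHandlebody T 0) c' ∧ ¬ (Literature.Topology.FourManifolds.Trisection.BoundsDisc T (Literature.Topology.FourManifolds.Trisection.spineHandlebody T 1) c ∧ Literature.Topology.FourManifolds.Trisection.BoundsDisc T (Literature.Topology.FourManifolds.Trisection.spineHandlebody T 2) c)) → ¬ Literature.Topology.FourManifolds.Trisection.IsReducible T → (∃ (g₁ : ℕ) (k₁ : Fin 3 → ℕ) (T₁ : Fin 3 → Set M), g₁ < g ∧ Literature.Topology.FourManifolds.IsGKTrisection M g₁ k₁ T₁) ∨ (∃ (X : Type) (_ : TopologicalSpace X) (_ : T2Space X) (_ : SecondCountableTopology X) (_ : ChartedSpace (EuclideanSpace ℝ (Fin 4)) X) (_ : IsManifold (𝓡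 4) ((⊤ : ℕ∞) : WithTop ℕ∞) X) (g' : ℕ) (k' : Fin 3 → ℕ) (T' : Fin 3 → Set X) (ℓ : (Metric.sphere (0 : EuclideanSpace ℝ (Fin 2)) 1) → X), g' < g ∧ Literature.Topology.FourManifolds.IsGKTrisection X g' k' T' ∧ Manifold.IsSmoothEmbedding (𝓡 1) (𝓡 4) ((⊤ : ℕ∞) : WithTop ℕ∞) ℓ ∧ Literature.Topology.FourManifolds.IsCircleSurgery (𝓡 4) (𝓡 4) X M ℓ)) → ∀ (M : Type) [TopologicalSpace M] [T2Space M] [SecondCountableTopology M] [ChartedSpace (EuclideanSpace ℝ (Fin 4)) M] [IsManifold (𝓡 4) ((⊤ : ℕ∞) : WithTop ℕ∞) M], (M ≃ₕ (Metric.sphere (0 : EuclideanSpace ℝ (Fin 5)) 1)) → ∀ (g : ℕ) (k : Fin 3 → ℕ) (T : Fin 3 → Set M), Literature.Topology.FourManifolds.IsGKTrisection M g k T → 5 ≤ g → k 0 + k 1 + k 2 = g → (∀ i, k i + 2 ≤ g) → 1 ≤ k 0 → k 2 ≤ k 1 → (∃ c c' : Set M, Literature.Topology.FourManifolds.Trisection.IsCurve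 T c ∧ Literature.Topology.FourManifolds.Trisection.IsCurve T c' ∧ Disjoint c c' ∧ Literature.Topology.FourManifolds.Trisection.IsNonSeparating T c ∧ Literature.Topology.FourManifolds.Trisection.IsNonSeparating T c' ∧ Literature.Topology.FourManifolds.Trisection.BoundsDisc T (Literature.Topology.FourManifolds.Trisection.spineHandlebody T 0) c ∧ Literature.Topology.FourManifolds.Trisection.BoundsDisc T (Literature.Topology.FourManifolds.Trisection.spineHandlebody T 1) c' ∧ Literature.Topology.FourManifolds.Trisection.BoundsDisc T (Literature.Topology.FourManifolds.Trisection.spineHandlebody T 2) c') → ¬ Literature.Topology.FourManifolds.Trisection.IsReducible T → (∃ (g₁ : ℕ) (k₁ : Fin 3 → ℕ) (T₁ : Fin 3 → Set M), g₁ < g ∧ Literature.Topology.FourManifolds.IsGKTrisection M g₁ k₁ T₁) ∨ (∃ (X : Type) (_ : TopologicalSpace X) (_ : T2Space X) (_ : SecondCountableTopology X) (_ : ChartedSpace (EuclideanSpace ℝ (Fin 4)) X) (_ : IsManifold (𝓡 4) ((⊤ : ℕ∞) : WithTop ℕ∞) X) (g' : ℕ) (k' : Fin 3 → ℕ) (T'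 : Fin 3 → Set X) (ℓ : (Metric.sphere (0 : EuclideanSpace ℝ (Fin 2)) 1) → X), g' < g ∧ Literature.Topology.FourManifolds.IsGKTrisection X g' k' T' ∧ Manifold.IsSmoothEmbedding (𝓡 1) (𝓡 4) ((⊤ : ℕ∞) : WithTop ℕ∞) ℓ ∧ Literature.Topology.FourManifolds.IsCircleSurgery (𝓡 4) (𝓡 4) X M ℓ) := by
  intro hG M _ _ _ _ _ e g k T hT hg hsum hk hk0 h21 hwr hirr
  obtain ⟨c, c', hc, hc', hd, hn, hn', hb0, hb1, hb2⟩ := hwr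
  obtain ⟨hg0, hg12⟩ := genuine_of_weakReduction_of_homotopyEquiv e hT hc hc' hn hn' hb0 hb1 hb2
  exact hG M e g k T hT hg hsum hk hk0 h21 ⟨c, c', hc, hc', hd, hn, hn', hb0, hb1, hb2, hg0, hg12⟩ hirr

/-- **`helper_rungFour_of_coreFourGenuine_msz` — THE RUNG-4 MILESTONE: `K2 at genus 4 ⇐ CORE₄ᵍ ∧
MSZ16 Thm 1.2`** (registered helper).  For a smooth homotopy 4-sphere `M` and a weakly reducible
`(4; k)`-GK-trisection `T` of MINIMAL genus, `T` is reducible — given the genuine core at genus 4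
and the Meier–Schirmer–Zupan classification.  `Σ kᵢ = 4` by `χ = 2`; an MSZ type gives `M ≅ S⁴`
(not minimal); else D₄ from CORE₄ᵍ: reducible, or a smaller trisection (not minimal), or a loop
surgery on a genus-`≤ 3` partner, which L₃ (MSZ `χ = 0` range + Pao) turns into `M ≅ S⁴` (not
minimal). [cite: ArandaZupan2025, Thm. 1.3 (p. 2), §5] [cite: MeierSchirmerZupan2016, Thm. 1.2, Remark 3.12] [cite: Pao1977, Thm] -/
theorem helper_rungFour_of_coreFourGenuine_msz :
    (∀ (M : Type) [TopologicalSpace M] [T2Space M] [SecondCountableTopology M] [ChartedSpace (EuclideanSpace ℝ (Fin 4)) M] [IsManifold (𝓡 4) ((⊤ : ℕ∞) : WithTop ℕ∞) M], (M ≃ₕ (Metric.sphere (0 : EuclideanSpace ℝ (Fin 5)) 1)) → ∀ (k : Fin 3 → ℕ) (T : Fin 3 → Set M), Literature.Topology.FourManifolds.IsGKTrisection M 4 k T → k 0 + k 1 + k 2 = 4 → (∀ i, k i ≤ 2) → 1 ≤ k 0 → k 2 ≤ k 1 → (∃ c c' : Set M, Literature.Topology.FourManifolds.Trisection.IsCurve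 T c ∧ Literature.Topology.FourManifolds.Trisection.IsCurve T c' ∧ Disjoint c c' ∧ Literature.Topology.FourManifolds.Trisection.IsNonSeparating T c ∧ Literature.Topology.FourManifolds.Trisection.IsNonSeparating T c' ∧ Literature.Topology.FourManifolds.Trisection.BoundsDisc T (Literature.Topology.FourManifolds.Trisection.spineHandlebody T 0) c ∧ Literature.Topology.FourManifolds.Trisection.BoundsDisc T (Literature.Topology.FourManifolds.Trisection.spineHandlebody T 1) c' ∧ Literature.Topology.FourManifolds.Trisection.BoundsDisc T (Literature.Topology.FourManifolds.Trisection.spineHandlebody T 2) c' ∧ ¬ Literature.Topology.FourManifolds.Trisection.BoundsDisc T (Literature.Topology.FourManifolds.Trisection.spineHandlebody T 0) c' ∧ ¬ (Literature.Topology.FourManifolds.Trisection.BoundsDisc T (Literature.Topology.FourManifolds.Trisection.spineHandlebody T 1) c ∧ Literature.Topology.FourManifolds.Trisection.BoundsDisc T (Literature.Topology.FourManifolds.Trisection.spineHandlebody T 2) c)) → ¬ Literature.Topology.FourManifolds.Trisection.IsReducible T → (∃ (g₁ : ℕ) (k₁ : Fin 3 → ℕ) (T₁ : Fin 3 → Set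 M), g₁ < 4 ∧ Literature.Topology.FourManifolds.IsGKTrisection M g₁ k₁ T₁) ∨ (∃ (X : Type) (_ : TopologicalSpace X) (_ : T2Space X) (_ : SecondCountableTopology X) (_ : ChartedSpace (EuclideanSpace ℝ (Fin 4)) X) (_ : IsManifold (𝓡 4) ((⊤ : ℕ∞) : WithTop ℕ∞) X) (g' : ℕ) (k' : Fin 3 → ℕ) (T' : Fin 3 → Set X) (ℓ : (Metric.sphere (0 : EuclideanSpace ℝ (Fin 2)) 1) → X), g' < 4 ∧ Literature.Topology.FourManifolds.IsGKTrisection X g' k' T' ∧ Manifold.IsSmoothEmbedding (𝓡 1) (𝓡 4) ((⊤ : ℕ∞) : WithTop ℕ∞) ℓ ∧ Literature.Topology.FourManifolds.IsCircleSurgery (𝓡 4) (𝓡 4) X M ℓ)) → Literature.Topology.FourManifolds.msz_trisection_classification_gk.{0} → ∀ (M : Type) [TopologicalSpace M] [T2Space M] [SecondCountableTopology M] [ChartedSpace (EuclideanSpace ℝ (Fin 4)) M] [IsManifold (𝓡 4) ((⊤ : ℕ∞) : WithTop ℕ∞) M], (M ≃ₕ (Metric.sphere (0 : EuclideanSpace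 ℝ (Fin 5)) 1)) → ∀ (k : Fin 3 → ℕ) (T : Fin 3 → Set M), Literature.Topology.FourManifolds.IsGKTrisection M 4 k T → (∀ (g' : ℕ) (k' : Fin 3 → ℕ) (T' : Fin 3 → Set M), Literature.Topology.FourManifolds.IsGKTrisection M g' k' T' → 4 ≤ g') → Literature.Topology.FourManifolds.Trisection.IsWeaklyReducible T → Literature.Topology.FourManifolds.Trisection.IsReducible T := by
  intro hG hC M _ _ _ _ _ e k T hT hmin hwr
  -- D₄ from the genuine core, through the landed glue chain CORE₄ᵍ → CORE₄ⁿ → CORE₄ → D₄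
  have hD4 := helper_loopDichotomyFour_of_irreducibleCore
    (helper_loopDichotomyFourCore_of_normalised (helper_loopDichotomyFourCoreNorm_of_genuine hG))
  have hsum : 4 = k 0 + k 1 + k 2 :=
    Summit.SmoothPoincare4.SmoothPoincare4.Theorems.genus_eq_sum_of_isGKTrisection_of_homotopyEquiv M e hT
  -- the middle exit contradicts minimality
  have hnotlt : ∀ (g₁ : ℕ) (k₁ : Fin 3 → ℕ) (T₁ : Fin 3 → Set M), IsGKTrisection M g₁ k₁ T₁ → ¬ g₁ < 4 :=
    fun g₁ k₁ T₁ hT₁ hlt => absurd (hmin g₁ k₁ T₁ hT₁) (by omega)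
  have hnotΦ : ∀ Φ : M ≃ₘ⟮𝓡 4, 𝓡 4⟯ (Metric.sphere (0 : EuclideanSpace ℝ (Fin 5)) 1), False := fun Φ => by
    obtain ⟨g₁, k₁, T₁, hlt, hT₁⟩ := exists_genus_lt_of_diffeomorph_sphere Φ (g := 4) (by omega)
    exact hnotlt g₁ k₁ T₁ hT₁ hlt
  by_cases hk : ∃ i, 4 ≤ k i + 1
  · -- MSZ range: `M ≅ S⁴`
    haveI : CompactSpace M := hT.compactSpace
    haveI : SimplyConnectedSpace (Metric.sphere (0 : EuclideanSpace ℝ (Fin 5)) 1) := simplyConnectedSpace_sphere_four_holds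
    haveI : SimplyConnectedSpace M := e.simplyConnectedSpace
    obtain ⟨o⟩ := isOrientable_of_homotopyEquiv_sphere_four_holds M e
    obtain ⟨Φ⟩ := Literature.Barriers.SmoothPoincare4.msz_homotopySphere_gk_of_classification hC
      M o 4 k T hT hk e
    exact (hnotΦ Φ).elim
  · push Not at hk
    have hk' : ∀ i, k i ≤ 2 := fun i => by have := hk i; omega
    rcases hD4 M e k T hT hsum.symm hk' hwr with hred | ⟨g₁, k₁, T₁, hlt, hT₁⟩ |
        ⟨X, _, _, _, _, _, g', k', T', ℓ, hlt, hT', hℓ, hsurg⟩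
    · exact hred
    · exact (hnotlt g₁ k₁ T₁ hT₁ hlt).elim
    · -- loop exit at rung 4: L₃ (MSZ `χ = 0` range + Pao) makes `M ≅ S⁴`
      obtain ⟨Φ⟩ := helper_loopFromGenusThree_of_msz
        (msz_chiZero_circleProdSphereThree_gk_of_classification.{0, 0} hC)
        X g' k' T' hT' (by omega) ℓ hℓ M e hsurg
      exact (hnotΦ Φ).elim

end Summit.SmoothPoincare4.SmoothPoincare4.Theorems.WeakReductionReduces.LoopDichotomy

end
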